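import Mathlib

/-!
# Markman 2023 (JEMS 25) — §13 «Hyperholomorphic sheaves», the Mukai vector `w := (r, h, r)` (arXiv v4 p. 73 L13–19):
# «`(w, w)_{S⁺_X} = −r` and `g_w = r`», with (3.1), the sign remark p. 16 L6, the dimension count behind «`r ≥ 6`»,
# and the one-line arithmetic of LEMMA 13.2's proof («order = rank») — AS PRINTED, kernel-checked

E. Markman: [M23] *The monodromy of generalized Kummer varieties and algebraic cycles on their intermediate Jacobians*,
J. Eur. Math. Soc. 25 (2023) 231–321, doi 10.4171/jems/1199 — REFEREED; bib `Markman2023GeneralizedKummers`. Numbering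
and wording = arXiv:1805.11574 **v4** (PDF sha256/16 `8e695d427eba6593`, re-fetched by read-only GET), whose §13 item
numbers agree with the JEMS numbers of record (Lemma 13.1 ∕ 13.2 = JEMS pp. 308–309, Theorem 13.3 = JEMS p. 309; lit-2
gen-9 `HOME/lit/LIT2-WEIL.md` §BB, read first-hand on the EMS PDF); «v4 p. N L m» = PyMuPDF line `m` of page `N`, text
layer extracted and p. 73 L3–40 ∕ p. 12 L21–45 read BY EYE at seat lit-w-markman g21 (pub-hsemireg LIT-W, 2026-08-25) on the
renders `r_mar23v4_p73_L3-40.png`, `r_mar23v4_p12_sec3.png` in `HOME/lit/Markman-renders-litw-markman-g21/`. §13 is the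
section that PROVES [M23] Theorem 1.5 (algebraicity of the Hodge–Weil classes on abelian fourfolds of Weil type of
discriminant 1) from the hyperholomorphic sheaf `E_F`; this leaf kernel-checks only its opening arithmetic (row M-Mk8 of
the pub-hsemireg LIT-W table; W1 «twisted sheaves» column: the Brauer class of order `r`).

## What is printed (verbatim)

* §3 (v4 p. 12 L23–32): «Let `X` be an abelian surface. Set `S⁺ := ⊕_{i=0}^{2} H^{2i}(X, ℤ)`. The Mukai pairing on `S⁺` is
  given by (3.1) `⟨x, y⟩ := ∫_X (x₁y₁ − x₀y₂ − x₂y₀)`, where `x = (x₀, x₁, x₂)`, `y = (y₀, y₁, y₂)`, and `x_i, y_i` are the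
  graded summands in `H^{2i}(X, ℤ)`.»; p. 12 L39–42: «Assume that the moduli space `M_H(v)` … is non-empty. Then `M_H(v)`
  is smooth, connected, projective, and holomorphic symplectic of dimension `⟨v, v⟩ + 2` [Mu2].»
* §4 (v4 p. 16 L4–7): «Let `(•, •)_{S⁺}` and `(•, •)_{S⁻}` be the restrictions of the pairing (4.15) to `S⁺` and `S⁻`.
  Both are even symmetric unimodular bilinear pairings … Note that `−(•, •)_{S⁺}` is the pairing given in (3.1), which is
  known as the Mukai pairing [Mu3, Y].»
* §13 (v4 p. 72 L48–50): «Let `M(w) := M_H(w)` be a smooth and compact moduli space of `H`-stable sheaves of primitive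
  Mukai vector `w` of dimension `≥ 8` over an abelian surface `X`.» LEMMA 13.1 (p. 73 L3–7): «The Brauer class
  `α ∈ H²_an(M(w), 𝒪*_{M(w)})` of the universal sheaf has order divisible by
  `g_w := gcd{(w, λ) : λ ∈ S⁺_X, λ₂ ∈ H^{1,1}(X, ℤ)}`.» Proof, first sentence (L8): «The fiber `K_a(w)` of `M(w)` over
  `a ∈ Alb¹(M(w))` has dimension `≥ 4`, by assumption».
* §13 (v4 p. 73 L13–19): «Let `r` be an even integer satisfying `r ≥ 6`. Let `X` be an abelian surface with a cyclic
  Picard group generated by an ample class `H` with `h := c₁(H)` satisfying `(h, h)_{S⁺_X} = −(2r² + r)` (so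
  `∫_X h² = 2r² + r`). Set `w := (r, h, r)`. Then `(w, w)_{S⁺_X} = −r` and `g_w = r`.»
* LEMMA 13.2 (1) (p. 73 L20–25): «The sheaf `E_F` over `M(w)` in Theorem 11.1 is `α`-twisted by a Brauer class `α` of
  order equal to the rank `r` of `E_F`. …» Proof (L34–36): «The order of the Brauer class necessarily divides the rank
  of the sheaf. In our case the rank `r` divides the order of `α` by Lemma 13.1. Hence, they are equal.»

## The model and what is proved (0 `def`, 0 named fact, 0 sorry; nothing geometric)

With `NS(X) = ℤh` (cyclic Picard group) the Mukai vectors with algebraic middle component form `ℤ³ ∋ (x₀, b, x₂)`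
standing for `(x₀, b·h, x₂)`; `∫_X h² = N`. The pairings are taken as HYPOTHESES on an arbitrary function `P` (resp.
`M`) — `(x, y)_{S⁺} = −N·b·b′ + x₀y₂ + x₂y₀` (= minus (3.1), p. 16 L6) and `⟨x, y⟩ = N·b·b′ − x₀y₂ − x₂y₀` ((3.1)) — so no
definition is introduced. PROVED: `mukai_neg` ((3.1) vs `(•,•)_{S⁺}`); `pairing_h_h` («`(h, h)_{S⁺} = −(2r² + r)`» is the
normalisation `N = 2r² + r`); `pairing_w_w` («`(w, w)_{S⁺} = −r`»); `mukai_w_w` (`⟨w, w⟩ = r`), hence `dim M(w) =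
⟨w, w⟩ + 2 = r + 2` and «dimension `≥ 8`» ⟺ `r ≥ 6`, and the Albanese fibre `K_a(w)` of dimension `r + 2 − 4` has
«dimension `≥ 4`» ⟺ `r ≥ 6` (`dim_moduli`, `dim_ge_eight_iff`, `dim_fibre_ge_four_iff`; `dim Alb = dim(X × X̂) = 4`
BY VALUE); `pairing_w` («`(w, λ)`» for `λ = (a, b·h, c)` equals `r·(a + c − (2r + 1)b)`); «`g_w = r`» as: `r` divides
every `(w, λ)`, `(w, (1, 0, 0)) = r`, hence a natural number divides all the values `(w, λ)` iff it divides `r`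
(`r_dvd_pairing_w`, `pairing_w_unit`, `dvd_all_pairing_w_iff` — i.e. the printed gcd is `r`); LEMMA 13.2's proof
arithmetic (`order_eq_rank`: `o ∣ r`, `g ∣ o`, `g = r` ⟹ `o = r`); and a seat remark, ×0, not a printed sentence:
`∫h² = 2r² + r = r(2r + 1)` is even iff `r` is even (`even_two_mul_sq_add_iff`) — consistent with «Let `r` be an even
integer» since the intersection form of an abelian surface is even (BY VALUE). BY VALUE ∕ NOT formalised: `S⁺` as
cohomology, (4.15), Yoshioka, [Mu2], the Brauer class, Lemma 13.1's proof, [Ma9], Theorem 11.1, everything in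
Lemma 13.2 after «Hence, they are equal.». Honest framing: bookkeeping of printed arithmetic; nothing here bears on the
Hodge conjecture or re-proves a statement of [M23].
-/

namespace Literature.AlgebraicGeometry.HodgeTheory

namespace KummerModuliMukaiVector

/-! ### §A — (3.1) and `(•, •)_{S⁺} = −⟨•, •⟩` on Mukai vectors `(x₀, b·h, x₂)` with `∫h² = N` -/

section Pairing

variable (N : ℤ) (P : ℤ × ℤ × ℤ → ℤ × ℤ × ℤ → ℤ)
  (hP : ∀ x y : ℤ × ℤ × ℤ, P x y = -(N * x.2.1 * y.2.1) + x.1 * y.2.2 + x.2.2 * y.1)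
include hP

/-- «Note that `−(•, •)_{S⁺}` is the pairing given in (3.1), which is known as the Mukai pairing» — on vectors
`(x₀, b·h, x₂)`, `(y₀, b′·h, y₂)`: `(x, y)_{S⁺} = −⟨x, y⟩` with `⟨x, y⟩ = ∫(x₁y₁ − x₀y₂ − x₂y₀) = N b b′ − x₀y₂ − x₂y₀`.
[cite: Markman2023GeneralizedKummers, (3.1) and §4 p. 16 remark, JEMS 25 (2023); arXiv v4 p. 12 L26–31, p. 16 L6] -/
theorem mukai_neg (M : ℤ × ℤ × ℤ → ℤ × ℤ × ℤ → ℤ)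
    (hM : ∀ x y : ℤ × ℤ × ℤ, M x y = N * x.2.1 * y.2.1 - x.1 * y.2.2 - x.2.2 * y.1) (x y : ℤ × ℤ × ℤ) :
    P x y = -M x y := by
  rw [hP, hM]; ring

/-- `(•, •)_{S⁺}` is symmetric (an «even symmetric unimodular bilinear pairing»; symmetry only is used below).
[cite: Markman2023GeneralizedKummers, §4, JEMS 25 (2023); arXiv v4 p. 16 L4–5] -/
theorem pairing_symm (x y : ℤ × ℤ × ℤ) : P x y = P y x := by
  rw [hP, hP]; ring

/-- «`h := c₁(H)` satisfying `(h, h)_{S⁺_X} = −(2r² + r)` (so `∫_X h² = 2r² + r`)» — with `h = (0, 1·h, 0)`: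
`(h, h)_{S⁺} = −N`, so the printed normalisation is `N = ∫h² = 2r² + r`.
[cite: Markman2023GeneralizedKummers, §13, JEMS 25 (2023) p. 308; arXiv v4 p. 73 L14–18] -/
theorem pairing_h_h : P (0, 1, 0) (0, 1, 0) = -N := by
  rw [hP]; ring

/-- «Set `w := (r, h, r)`. Then `(w, w)_{S⁺_X} = −r`» — for `∫h² = 2r² + r`.
[cite: Markman2023GeneralizedKummers, §13, JEMS 25 (2023) p. 308; arXiv v4 p. 73 L18–19] -/
theorem pairing_w_w (r : ℤ) (hN : N = 2 * r ^ 2 + r) : P (r, 1, r) (r, 1, r) = -r := by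
  rw [hP, hN]; ring

/-- «`(w, λ)` : `λ ∈ S⁺_X`, `λ₂ ∈ H^{1,1}(X, ℤ)`» — with `NS(X) = ℤh`, `λ = (a, b·h, c)` and
`(w, λ)_{S⁺} = −(2r² + r)b + rc + ra = r·(a + c − (2r + 1)b)`.
[cite: Markman2023GeneralizedKummers, Lemma 13.1 and §13, JEMS 25 (2023) p. 308; arXiv v4 p. 73 L6–7, L13–19] -/
theorem pairing_w (r : ℤ) (hN : N = 2 * r ^ 2 + r) (a b c : ℤ) :
    P (r, 1, r) (a, b, c) = r * (a + c - (2 * r + 1) * b) := by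
  rw [hP, hN]; ring

/-- Hence `r` divides every value `(w, λ)`. [cite: Markman2023GeneralizedKummers, §13 («g_w = r»), JEMS 25 (2023) p. 308; arXiv v4 p. 73 L19] -/
theorem r_dvd_pairing_w (r : ℤ) (hN : N = 2 * r ^ 2 + r) (l : ℤ × ℤ × ℤ) : r ∣ P (r, 1, r) l := by
  obtain ⟨a, b, c⟩ := l
  rw [pairing_w N P hP r hN a b c]
  exact dvd_mul_right r _

/-- … and the value `r` is attained, at `λ = (1, 0, 0)` (the class of a point-free rank-one vector: `(w, (1,0,0)) = w₂ = r`).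
[cite: Markman2023GeneralizedKummers, §13 («g_w = r»), JEMS 25 (2023) p. 308; arXiv v4 p. 73 L19] -/
theorem pairing_w_unit (r : ℤ) (hN : N = 2 * r ^ 2 + r) : P (r, 1, r) (1, 0, 0) = r := by
  rw [pairing_w N P hP r hN]; ring

/-- «`g_w = r`»: `g_w := gcd{(w, λ)}` is `r` — a number divides ALL the values `(w, λ)`, `λ = (a, b·h, c)`, iff it
divides `r` (so `|r|` is the greatest common divisor of the value set, and the value set is the ideal `rℤ`).
[cite: Markman2023GeneralizedKummers, §13, JEMS 25 (2023) p. 308; arXiv v4 p. 73 L19] -/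
theorem dvd_all_pairing_w_iff (r : ℤ) (hN : N = 2 * r ^ 2 + r) (g : ℤ) :
    (∀ l : ℤ × ℤ × ℤ, g ∣ P (r, 1, r) l) ↔ g ∣ r := by
  refine ⟨fun h => ?_, fun h l => dvd_trans h (r_dvd_pairing_w N P hP r hN l)⟩
  have := h (1, 0, 0)
  rwa [pairing_w_unit N P hP r hN] at this

/-- The value set `{(w, λ)}` is exactly the set of multiples of `r` (so its gcd is `|r|`).
[cite: Markman2023GeneralizedKummers, §13 («g_w = r»), JEMS 25 (2023) p. 308; arXiv v4 p. 73 L19] -/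
theorem range_pairing_w (r : ℤ) (hN : N = 2 * r ^ 2 + r) :
    Set.range (fun l : ℤ × ℤ × ℤ => P (r, 1, r) l) = {v : ℤ | r ∣ v} := by
  ext v
  constructor
  · rintro ⟨l, rfl⟩
    exact r_dvd_pairing_w N P hP r hN l
  · rintro ⟨m, rfl⟩
    refine ⟨(m, 0, 0), ?_⟩
    show P (r, 1, r) (m, 0, 0) = r * m
    rw [pairing_w N P hP r hN]
    ring

end Pairing

/-! ### §B — `⟨w, w⟩ = r`: «dimension `⟨v, v⟩ + 2`», «of dimension `≥ 8`», «has dimension `≥ 4`, by assumption» -/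

/-- (3.1) on `w = (r, h, r)` with `∫h² = 2r² + r`: `⟨w, w⟩ = ∫h² − 2·r·r = r`.
[cite: Markman2023GeneralizedKummers, (3.1) and §13, JEMS 25 (2023); arXiv v4 p. 12 L26–31, p. 73 L18–19] -/
theorem mukai_w_w (r : ℤ) : (2 * r ^ 2 + r) * 1 * 1 - r * r - r * r = r := by ring

/-- «holomorphic symplectic of dimension `⟨v, v⟩ + 2`»: for `w`, `dim M(w) = r + 2`.
[cite: Markman2023GeneralizedKummers, §3, JEMS 25 (2023); arXiv v4 p. 12 L41–42, with §13 p. 73 L18–19] -/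
theorem dim_moduli (r : ℤ) : ((2 * r ^ 2 + r) * 1 * 1 - r * r - r * r) + 2 = r + 2 := by ring

/-- «… of primitive Mukai vector `w` of dimension `≥ 8`» ⟺ «`r ≥ 6`» (`dim M(w) = r + 2`).
[cite: Markman2023GeneralizedKummers, §13, JEMS 25 (2023) p. 308; arXiv v4 p. 72 L48–50, p. 73 L13] -/
theorem dim_ge_eight_iff (r : ℤ) : 8 ≤ r + 2 ↔ 6 ≤ r := by omega

/-- «The fiber `K_a(w)` of `M(w)` over `a ∈ Alb¹(M(w))` has dimension `≥ 4`, by assumption» — the Albanese fibre has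
dimension `dim M(w) − dim(X × X̂) = (r + 2) − 4` (`dim X × X̂ = 4` BY VALUE), and `≥ 4` ⟺ `r ≥ 6` ⟺ `dim M(w) ≥ 8`.
[cite: Markman2023GeneralizedKummers, Lemma 13.1 (proof, first sentence), JEMS 25 (2023) p. 308; arXiv v4 p. 73 L8, p. 12 L42–45] -/
theorem dim_fibre_ge_four_iff (r : ℤ) : 4 ≤ (r + 2) - 4 ↔ 6 ≤ r := by omega

/-- Seat remark (×0 — the print says only «Let `r` be an even integer»): `∫h² = 2r² + r = r(2r + 1)` is EVEN iff `r`
is even; since the intersection form of an abelian surface is even (BY VALUE), an `h` with `∫h² = 2r² + r` requires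
`r` even. [cite: Markman2023GeneralizedKummers, §13, JEMS 25 (2023) p. 308; arXiv v4 p. 73 L13–18 (parity hypothesis; the «iff» is folklore arithmetic)] -/
theorem even_two_mul_sq_add_iff (r : ℤ) : Even (2 * r ^ 2 + r) ↔ Even r := by
  constructor
  · intro h
    have h2 : Even (2 * r ^ 2) := ⟨r ^ 2, by ring⟩
    exact (Int.even_add.mp h).mp h2
  · rintro ⟨k, rfl⟩
    exact ⟨4 * k ^ 2 + k, by ring⟩

/-! ### §C — LEMMA 13.2, proof: «order divides rank; rank divides order (Lemma 13.1, `g_w = r`); hence equal» -/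

/-- LEMMA 13.2 (1), the printed argument: «The order of the Brauer class necessarily divides the rank of the sheaf. In
our case the rank `r` divides the order of `α` by Lemma 13.1. Hence, they are equal.» — with `o` the order, `r` the
rank, `g = g_w`: `o ∣ r`, `g ∣ o` (Lemma 13.1, BY VALUE) and `g = r` (§13 p. 73 L19) give `o = r`.
[cite: Markman2023GeneralizedKummers, Lemma 13.2 (proof), JEMS 25 (2023) p. 309; arXiv v4 p. 73 L34–36] -/
theorem order_eq_rank {o r g : ℕ} (h1 : o ∣ r) (h2 : g ∣ o) (hg : g = r) : o = r := by
  subst hg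
  exact Nat.dvd_antisymm h1 h2

/-- The same over `ℤ` for the lattice value `g_w = r` as it comes out of §A (`r ≥ 6 > 0`): the order `o : ℕ` with
`(o : ℤ) ∣ r` and `r ∣ o` equals `r`. [cite: Markman2023GeneralizedKummers, Lemma 13.2 (proof), JEMS 25 (2023) p. 309; arXiv v4 p. 73 L34–36] -/
theorem order_eq_rank_int {o : ℕ} {r : ℤ} (hr : 0 ≤ r) (h1 : (o : ℤ) ∣ r) (h2 : r ∣ (o : ℤ)) : (o : ℤ) = r :=
  Int.dvd_antisymm (Int.natCast_nonneg o) hr h1 h2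

/-! ### Numerals (sanity instances; `example`s carry no tag)

`r = 6` (the smallest admissible): `∫h² = 78`, `w = (6, h, 6)`, `(w, w)_{S⁺} = −78 + 72 = −6`, `dim M(w) = 8`,
Albanese fibre dimension `4`; `(w, (a, b·h, c)) = 6(a + c − 13b)`. `r = 8`: `∫h² = 136`, `(w, w)_{S⁺} = −8`, `dim = 10`. -/

example : (2 * (6:ℤ) ^ 2 + 6) = 78 ∧ -(78 * 1 * 1) + (6:ℤ) * 6 + 6 * 6 = -6 := by norm_num
example : (2 * (8:ℤ) ^ 2 + 8) = 136 ∧ -(136 * 1 * 1) + (8:ℤ) * 8 + 8 * 8 = -8 := by norm_num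
example (a b c : ℤ) : -(78 * 1 * b) + (6:ℤ) * c + 6 * a = 6 * (a + c - 13 * b) := by ring

end KummerModuliMukaiVector

end Literature.AlgebraicGeometry.HodgeTheory
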